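import Literature.Barriers.HodgeConjecture.GeneralizedHodgeTrivialReasonsProofs
import Literature.AlgebraicGeometry.Motives.MixedHodgeStructureOfPairProofs
import Mathlib.LinearAlgebra.TensorProduct.Pi
import Mathlib.LinearAlgebra.FiniteDimensional.Lemmas
import Mathlib.Algebra.BigOperators.Ring.Finset
import Mathlib.Algebra.BigOperators.Group.Finset.Piecewise
import Mathlib.Data.Fintype.BigOperators
import HarnessLib

/-!
# Grothendieck (1969), p. 300, on the layer where it is printed and provable: the Hodge structure
# `H¹(E_τ) ⊗ H¹(E_τ) ⊗ H¹(E_τ)`, `τ` cubic, violates Hodge's "general conjecture" (PROVED)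

Companion to the barrier `Literature.Barriers.HodgeConjecture.Grothendieck1969_generalHodgeConjecture_false`
(`GeneralizedHodgeTrivialReasons.lean`). That named fact renders Grothendieck's counterexample
GEOMETRICALLY (a smooth projective threefold `X`, a Hodge model of `X`, a rational class of
`F¹H³(X)` outside `N¹H³(X)`); its discharge is a theory — it is closed in the tree only modulo the
named facts `HodgeTheory.nonempty_hodgeModel`, `exists_deRhamIsoFamily`,
`exists_complexDeRhamIsoFamily`, `hodgePQ_independent_of_hodgeModel`,
`Deligne1974_ker_restrictCompl_eq_iSup_range_complexGysin`, `Hironaka1964_projective` and an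
algebraic model of the torus `ℂ³/(ℤ + τℤ)³` (`Grothendieck1969_generalHodgeConjecture_false_of_deRham`,
`…SubHodgeOfFacts.lean`; `Grothendieck1969_ellipticCurveCubed_hodgeDecomposition_of_models`,
`…EllipticCurveCubedRational.lean`). What Grothendieck's note itself PROVES is a statement of
pure Hodge theory, and this file proves it on the tree's abstract layer of `ℚ`-Hodge structures
(`Literature.AlgebraicGeometry.Motives.HodgeStructure`, the layer of the tree's generalised Hodge
conjecture `Motives/AbstractHodgeTate`). Source read: A. Grothendieck, *Hodge's general
conjecture is false for trivial reasons*, Topology 8 (1969) 299–303, p. 300, verbatim: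

* "Now equality in (∗) would imply a highly non trivial intrinsic condition on the Hodge
  structure `Hⁱ(X^an, ℂ)`, namely that the `ℂ`-vector-subspace generated by the right hand side
  of (∗) [`Filtᵖ Hⁱ(X^an, ℂ) ∩ Hⁱ(X^an, ℚ)`] is a sub-Hodge structure; If `i` is odd, this would
  imply for instance that the dimension over `ℚ` of that space is even."
* "already for `i = 3`, `p = 1`, it becomes non empty, and may in fact not be satisfied for the
  threefold product of an elliptic curve with itself. To see this, let us take more generally
  `i` elliptic curves over `ℂ`, with lattice periods generated by `1, τ_α` (`1 ≤ α ≤ i`). The rank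
  of `Filt¹ Hⁱ(X, ℚ)`, where `X` is the product of the elliptic curves, is immediately computed,
  it is equal to `2ⁱ - N`, where `N` is the rank of the vector space over `ℚ` generated by all
  `j`-fold products, `0 ≤ j ≤ i`, of `τ_α`'s with distinct indices […]. If `i` is odd, this rank
  may well be odd; for instance if `i = 3`, and all `τᵢ` equal to the same `τ`, this will happen
  exactly when `τ` is cubic over `ℚ`."

## Results (all PROVED; no named fact, D-0026)

* `HodgeStructure.SubHodgeStructure.even_finrank`,
  `HodgeStructure.SubHodgeStructure.toSubmodule_ne_of_odd_finrank` — Grothendieck's necessary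
  condition on the abstract layer: a sub-Hodge structure of a `ℚ`-Hodge structure of ODD weight
  has even `ℚ`-dimension (from the tree's `HodgeStructure.even_finrank_of_odd`, Voisin I
  Cor. 6.13), so a `ℚ`-subspace of odd dimension — in particular Hodge's `V ∩ Fᵖ`
  (`HodgeStructure.hodgeClasses p`) when it has odd dimension — underlies no sub-Hodge structure.
* `HodgeStructure.ofConjBasis` — a pure Hodge structure of weight `n` from a `ℂ`-basis `ω` of
  `V_ℂ` graded by `deg : κ → ℤ` and permuted by complex conjugation through an index map `σ` with
  `deg k + deg (σ k) = n` (`F^p = ⟨ω_k : deg k ≥ p⟩`, `V^{p,q} = ⟨ω_k : deg k = p⟩`; Deligne,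
  Hodge II, 1.2.5), with its filtration/pieces/`hodgeClasses` API.
* `EllipticCurveCubed.hodgeStructure τ` — THE Hodge structure `H¹(E_τ, ℚ)^{⊗3}` of weight `3` on
  `ℚ⁸ = ℚ^{(Fin 3 → Bool)}` for `E_τ = ℂ/(ℤ + τℤ)`, `Im τ ≠ 0`: in the basis `e_S = ⊗_a e_{S a}` of
  `H¹(E_τ, ℚ)^{⊗3}` (`e_false = dx`, `e_true = dy` dual to the lattice basis `1, τ`, so that
  `[dz] = dx + τ dy`, `[dz̄] = dx + τ̄ dy`, Lange–Birkenhake §1.1.4–§1.1.5), the vectors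
  `ω_T = ⊗_a [dz_a or dz̄_a]` (`T a = true` for `dz`), of type `(p, 3 - p)` with
  `p = #{a | T a}`, conjugation swapping `T` and its complement.
* `EllipticCurveCubed.finrank_hodgeClasses_one_add_finrank_span_pow` — **Grothendieck's count
  `rank = 2ⁱ - N`** (`i = 3`, equal periods): for every `τ` with `Im τ ≠ 0`,
  `dim_ℚ (V ∩ F¹) + dim_ℚ ⟨1, τ, τ², τ³⟩_ℚ = 2³` (a rational vector lies in
  `F¹ = ⟨ω_T : T ≠ dz̄dz̄dz̄⟩` iff its `dz̄ ∧ dz̄ ∧ dz̄`-coordinate `Σ_S (-τ)^{#{a | ¬ S a}} v_S` vanishes,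
  `EllipticCurveCubed.hodgeClasses_one_eq_ker`; the values of this relation span `⟨1, τ, τ², τ³⟩_ℚ`,
  `EllipticCurveCubed.range_periodRel`); `EllipticCurveCubed.finrank_hodgeClasses_one`: `= 5` for
  `τ³ = 2` with `1, τ, τ²` linearly independent over `ℚ` (`N = 3`).
* `Grothendieck1969_hodgeGeneralConjecture_false_abstract` — **Hodge's general conjecture is
  false for trivial reasons, abstract form**: there is a `τ` (`exists_cubic_tau`,
  `…Proofs.lean`) for which `V ∩ F¹` of `EllipticCurveCubed.hodgeStructure τ` has odd dimension `5` and hence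
  is the underlying space of NO sub-Hodge structure — whereas Hodge's formulation `N¹H³ = H³_ℚ ∩ F¹`
  would force it to be one (`N¹ ⊗ ℂ` is a sub-Hodge structure, Grothendieck p. 300 with
  footnote † = Deligne; tree: `Grothendieck1969_supportedClasses_isSubHodge`).

The geometric barrier is this theorem plus two cited identifications which the tree keeps as
named facts: `H¹ ⊗ H¹ ⊗ H¹ ⊂ H³(E_τ³, ℚ)` IS `EllipticCurveCubed.hodgeStructure τ` (Künneth and the Hodge
decomposition of a complex torus, Lange–Birkenhake Thm. 1.1.21 / Prop. 1.1.23 —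
`Grothendieck1969_ellipticCurveCubed_hodgeDecomposition`), and `N¹H³(X, ℚ) ⊗ ℂ` is a sub-Hodge
structure inside `F¹` (`Grothendieck1969_supportedClasses_isSubHodge`,
`Grothendieck1969_supportedClasses_le_hodgeFiltration`).

## Design

* The general constructions (`complexConj_span`, `involutive_of_conj_basis`,
  `complexConj_span_image_deg_ge`, `ofConjBasis` and its API, `SubHodgeStructure.even_finrank`,
  `SubHodgeStructure.toSubmodule_ne_of_odd_finrank`) are dot-notation extensions of the tree's
  `Literature.AlgebraicGeometry.Motives.HodgeStructure` (directory `Motives/`) and are therefore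
  declared with their absolute names (CONVENTIONS §2); they use nothing from this catalogue and
  may be relocated next to `Motives/HodgeStructureWeil` (`ofSplitting`, the two-type analogue).
* The cube lives in the sub-namespace `EllipticCurveCubed` (it names the object `E_τ³`); its
  index type is `Fin 3 → Bool` (rational basis `e_S`, type basis `ω_T`), so that Grothendieck's
  count is a statement about `ℚ⁸` and the period relation `periodRel`
  (cf. `periodMap` of `…Proofs.lean`, the same relation on all of `H³(E_τ³, ℚ) ≅ ℚ²⁰`, rank
  `20 - 3 = 17`; here only the Künneth component `H¹ ⊗ H¹ ⊗ H¹ ≅ ℚ⁸`, rank `8 - 3 = 5`, exactly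
  Grothendieck's `2ⁱ - N`). The cubic period is `exists_cubic_tau` of `…Proofs.lean`.
* Nothing here is a named fact, and the geometric def is not edited or weakened — it keeps its
  name, statement and conditional proofs; this file is the barrier's restatement on the layer on
  which the source proves it (review of the barrier's split/debt status, 2026-08-15), proved.

## References

* [GrothendieckTopology1969] A. Grothendieck, Topology 8 (1969) 299–303, p. 300.
* [VoisinHodgeI2002] C. Voisin, *Hodge Theory and Complex Algebraic Geometry I*, §7.1.1
  (Hodge structures, `F^p = ⊕_{i ≥ p} V^{i,n-i}`), Cor. 6.13, §7.3.1 Def. 7.24, §11.3.3 Thm. 11.40.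
* [LangeBirkenhake1992] H. Lange, Ch. Birkenhake, *Complex Abelian Varieties*, §1.1.4
  Prop. 1.1.20, §1.1.5 Thm. 1.1.21 and Prop. 1.1.23 (Hodge decomposition of a complex torus in
  the basis `dz_I ∧ dz̄_J`).
* [DeligneHodgeII1971] P. Deligne, Théorie de Hodge II, 1.2.5 (bigradings and opposed filtrations).
-/

noncomputable section

open scoped TensorProduct
open Module

namespace Literature.Barriers.HodgeConjecture

open Literature.AlgebraicGeometry.Motives
open Literature.AlgebraicGeometry.Motives.HodgeStructure (complexConj ofRat conj_conj conj_tmul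
  mem_complexConj ofRat_apply mem_hodgeClasses_iff)

/-! ### Grothendieck's necessary condition on the abstract layer -/

section Parity

universe u

variable {V : Type u} [AddCommGroup V] [Module ℚ V] {n : ℤ}

/-- **A sub-Hodge structure of a Hodge structure of odd weight has even `ℚ`-dimension**: the
induced Hodge structure on it (`SubHodgeStructure.toHodgeStructure`) has the same odd weight,
and a `ℚ`-Hodge structure of odd weight lives on an even-dimensional space
(`HodgeStructure.even_finrank_of_odd`: `W_ℂ = F^{m+1} ⊕ conj F^{m+1}` for weight `2m + 1`).
Grothendieck: "If `i` is odd, this would imply for instance that the dimension over `ℚ` of that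
space is even." [cite: GrothendieckTopology1969, p. 300] [cite: VoisinHodgeI2002, Cor. 6.13] -/
theorem _root_.Literature.AlgebraicGeometry.Motives.HodgeStructure.SubHodgeStructure.even_finrank
    {H : HodgeStructure V n} (S : H.SubHodgeStructure) (hn : Odd n) :
    Even (Module.finrank ℚ S.toSubmodule) :=
  S.toHodgeStructure.even_finrank_of_odd hn

/-- **Grothendieck's intrinsic necessary condition**: in odd weight, a `ℚ`-subspace of odd finite
dimension is the underlying space of no sub-Hodge structure. Applied to Hodge's right hand side
of (∗), `W = V ∩ Fᵖ` (`HodgeStructure.hodgeClasses p`): if `dim_ℚ W` is odd, `W` "generates no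
sub-Hodge structure", so it cannot be `Filt'ᵖ`. [cite: GrothendieckTopology1969, p. 300] -/
theorem _root_.Literature.AlgebraicGeometry.Motives.HodgeStructure.SubHodgeStructure.toSubmodule_ne_of_odd_finrank
    {H : HodgeStructure V n} (S : H.SubHodgeStructure) (hn : Odd n) {W : Submodule ℚ V}
    (hW : Odd (Module.finrank ℚ W)) : S.toSubmodule ≠ W := by
  rintro rfl
  exact Nat.not_even_iff_odd.2 hW (S.even_finrank hn)

end Parity

/-! ### Hodge structures from a conjugation-graded basis -/

section OfConjBasis

universe u

variable {V : Type u} [AddCommGroup V] [Module ℚ V] {κ : Type*} {n : ℤ}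

/-- The conjugate of a span is the span of the conjugates (`conj` is an antilinear involution of
`V_ℂ`). [folklore] -/
theorem _root_.Literature.AlgebraicGeometry.Motives.HodgeStructure.complexConj_span
    (s : Set (ℂ ⊗[ℚ] V)) :
    complexConj (Submodule.span ℂ s) = Submodule.span ℂ (HodgeStructure.conj '' s) := by
  have key : ∀ t : Set (ℂ ⊗[ℚ] V),
      Submodule.span ℂ (HodgeStructure.conj '' t) ≤ complexConj (Submodule.span ℂ t) := by
    intro t
    rw [Submodule.span_le]
    rintro _ ⟨x, hx, rfl⟩
    rw [SetLike.mem_coe, mem_complexConj, conj_conj]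
    exact Submodule.subset_span hx
  refine le_antisymm (fun x hx ↦ ?_) (key s)
  have hss : HodgeStructure.conj '' (HodgeStructure.conj '' s) = s := by
    rw [Set.image_image]
    simp only [conj_conj, Set.image_id']
  have h := key (HodgeStructure.conj '' s)
  rw [hss] at h
  have hx' := h (mem_complexConj.1 hx)
  rwa [mem_complexConj, conj_conj] at hx'

/-- If complex conjugation permutes a basis through the index map `σ`, then `σ` is an involution
(`conj` is one). [folklore] -/
theorem _root_.Literature.AlgebraicGeometry.Motives.HodgeStructure.involutive_of_conj_basis
    (ω : Basis κ ℂ (ℂ ⊗[ℚ] V)) (σ : κ → κ) (hσ : ∀ k, HodgeStructure.conj (ω k) = ω (σ k)) :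
    Function.Involutive σ := by
  intro k
  apply ω.injective
  rw [← hσ (σ k), ← hσ k, conj_conj]

/-- Two parts of a basis span subspaces meeting in the span of the common part. [folklore] -/
private theorem span_image_inf_span_image (ω : Basis κ ℂ (ℂ ⊗[ℚ] V)) (s t : Set κ) :
    Submodule.span ℂ (ω '' s) ⊓ Submodule.span ℂ (ω '' t) = Submodule.span ℂ (ω '' (s ∩ t)) := by
  refine le_antisymm (fun x hx ↦ ?_) (le_inf (Submodule.span_mono (Set.image_mono
    Set.inter_subset_left)) (Submodule.span_mono (Set.image_mono Set.inter_subset_right)))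
  rw [ω.mem_span_image, Set.subset_inter_iff]
  exact ⟨ω.mem_span_image.1 hx.1, ω.mem_span_image.1 hx.2⟩

/-- The conjugate of a step `⟨ω_k : q ≤ deg k⟩` of the basis filtration is the complementary step
`⟨ω_k : deg k ≤ n - q⟩` when `conj ω_k = ω_{σ k}` and `deg k + deg (σ k) = n`.
[cite: DeligneHodgeII1971, 1.2.5] -/
theorem _root_.Literature.AlgebraicGeometry.Motives.HodgeStructure.complexConj_span_image_deg_ge
    (ω : Basis κ ℂ (ℂ ⊗[ℚ] V)) (deg : κ → ℤ) (σ : κ → κ)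
    (hσ : ∀ k, HodgeStructure.conj (ω k) = ω (σ k)) (hdeg : ∀ k, deg k + deg (σ k) = n) (q : ℤ) :
    complexConj (Submodule.span ℂ (ω '' {k | q ≤ deg k})) =
      Submodule.span ℂ (ω '' {k | deg k ≤ n - q}) := by
  have hinv := HodgeStructure.involutive_of_conj_basis ω σ hσ
  rw [HodgeStructure.complexConj_span, Set.image_image]
  congr 1
  ext x
  simp only [Set.mem_image, Set.mem_setOf_eq]
  constructor
  · rintro ⟨k, hk, rfl⟩
    exact ⟨σ k, by have := hdeg k; omega, (hσ k).symm⟩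
  · rintro ⟨j, hj, rfl⟩
    exact ⟨σ j, by have := hdeg j; omega, by rw [hσ, hinv j]⟩

variable [Fintype κ]

/-- `|deg k| ≤ Σⱼ |deg j|` (bounds for exhaustion/separation of the filtration). [folklore] -/
private theorem abs_deg_le (deg : κ → ℤ) (k : κ) : |deg k| ≤ ∑ j, |deg j| :=
  Finset.single_le_sum (f := fun j ↦ |deg j|) (fun j _ ↦ abs_nonneg (deg j)) (Finset.mem_univ k)

/-- **The pure Hodge structure of a conjugation-graded basis.** Let `ω` be a `ℂ`-basis of
`V_ℂ = ℂ ⊗ V` indexed by a finite type `κ`, `deg : κ → ℤ` ("`ω_k` has type `(deg k, n - deg k)`")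
and `σ : κ → κ` with `conj ω_k = ω_{σ k}` and `deg k + deg (σ k) = n`. Then
`F^p := ⟨ω_k : p ≤ deg k⟩_ℂ` is a pure Hodge structure of weight `n` on `V`: `F` is decreasing,
`F^p = V_ℂ` for `p ≪ 0`, `F^p = 0` for `p ≫ 0`, and for `p + q = n + 1`,
`conj F^q = ⟨ω_k : deg k < p⟩` is spanned by the complementary part of the basis, so
`V_ℂ = F^p ⊕ conj F^q` (Deligne, Hodge II, 1.2.5: a bigrading `V_ℂ = ⊕ V^{p,q}` with
`conj V^{p,q} = V^{q,p}` is the same as a filtration `n`-opposed to its conjugate; Voisin I,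
§7.1.1, `F^p = ⊕_{i ≥ p} V^{i,n-i}`). [cite: DeligneHodgeII1971, 1.2.5] [cite: VoisinHodgeI2002, §7.1.1] -/
def _root_.Literature.AlgebraicGeometry.Motives.HodgeStructure.ofConjBasis
    (ω : Basis κ ℂ (ℂ ⊗[ℚ] V)) (deg : κ → ℤ) (σ : κ → κ)
    (hσ : ∀ k, HodgeStructure.conj (ω k) = ω (σ k)) (hdeg : ∀ k, deg k + deg (σ k) = n) :
    HodgeStructure V n where
  F p := Submodule.span ℂ (ω '' {k | p ≤ deg k})
  antitone_F _ _ hpp' := Submodule.span_mono (Set.image_mono fun _ hk ↦ hpp'.trans hk)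
  exists_F_eq_top := by
    refine ⟨-∑ j, |deg j|, ?_⟩
    have h : {k | -∑ j, |deg j| ≤ deg k} = Set.univ :=
      Set.eq_univ_of_forall fun k ↦ (neg_le_neg (abs_deg_le deg k)).trans (neg_abs_le (deg k))
    rw [h, Set.image_univ, ω.span_eq]
  exists_F_eq_bot := by
    refine ⟨∑ j, |deg j| + 1, ?_⟩
    have h : {k | ∑ j, |deg j| + 1 ≤ deg k} = ∅ :=
      Set.eq_empty_of_forall_notMem fun k (hk : ∑ j, |deg j| + 1 ≤ deg k) ↦ by
        have := (le_abs_self (deg k)).trans (abs_deg_le deg k)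
        omega
    rw [h, Set.image_empty, Submodule.span_empty]
  isCompl_F_complexConj p q hpq := by
    rw [HodgeStructure.complexConj_span_image_deg_ge ω deg σ hσ hdeg q]
    have hc : {k | deg k ≤ n - q} = {k | p ≤ deg k}ᶜ := by
      ext k
      simp only [Set.mem_setOf_eq, Set.mem_compl_iff, not_le]
      omega
    rw [hc]
    exact ⟨ω.linearIndependent.disjoint_span_image disjoint_compl_right, by
      rw [codisjoint_iff, ← Submodule.span_union, ← Set.image_union, Set.union_compl_self,
        Set.image_univ, ω.span_eq]⟩

variable (ω : Basis κ ℂ (ℂ ⊗[ℚ] V)) (deg : κ → ℤ) (σ : κ → κ)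
  (hσ : ∀ k, HodgeStructure.conj (ω k) = ω (σ k)) (hdeg : ∀ k, deg k + deg (σ k) = n)

/-- The Hodge filtration of `ofConjBasis`: `F^p = ⟨ω_k : p ≤ deg k⟩`. [cite: VoisinHodgeI2002, §7.1.1] -/
theorem _root_.Literature.AlgebraicGeometry.Motives.HodgeStructure.ofConjBasis_F (p : ℤ) :
    (HodgeStructure.ofConjBasis ω deg σ hσ hdeg).F p = Submodule.span ℂ (ω '' {k | p ≤ deg k}) :=
  rfl

/-- Membership in `F^p` of `ofConjBasis`: the `ω`-coordinates of index of degree `< p` vanish.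
[cite: VoisinHodgeI2002, §7.1.1] -/
theorem _root_.Literature.AlgebraicGeometry.Motives.HodgeStructure.mem_ofConjBasis_F_iff
    (x : ℂ ⊗[ℚ] V) (p : ℤ) :
    x ∈ (HodgeStructure.ofConjBasis ω deg σ hσ hdeg).F p ↔ ∀ k, deg k < p → ω.repr x k = 0 := by
  rw [HodgeStructure.ofConjBasis_F, ω.mem_span_image]
  constructor
  · intro h k hk
    by_contra hne
    exact not_le.2 hk (h (Finset.mem_coe.2 (Finsupp.mem_support_iff.2 hne)))
  · intro h k hk
    by_contra hpk
    exact Finsupp.mem_support_iff.1 (Finset.mem_coe.1 hk) (h k (not_le.1 hpk))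

/-- Hodge's `V ∩ Fᵖ` (`hodgeClasses p`) for `ofConjBasis`: the rational vectors whose
`ω`-coordinates of degree `< p` vanish. [cite: GrothendieckTopology1969, p. 299 (∗)] -/
theorem _root_.Literature.AlgebraicGeometry.Motives.HodgeStructure.mem_hodgeClasses_ofConjBasis_iff
    (v : V) (p : ℤ) :
    v ∈ (HodgeStructure.ofConjBasis ω deg σ hσ hdeg).hodgeClasses p ↔
      ∀ k, deg k < p → ω.repr (ofRat v) k = 0 := by
  rw [mem_hodgeClasses_iff, HodgeStructure.mem_ofConjBasis_F_iff]

/-- The Hodge pieces of `ofConjBasis`: `V^{p,q} = ⟨ω_k : deg k = p⟩` for `p + q = n`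
(`F^p ∩ conj F^q`, and `conj F^q = ⟨ω_k : deg k ≤ n - q = p⟩`). [cite: DeligneHodgeII1971, 1.2.5] -/
theorem _root_.Literature.AlgebraicGeometry.Motives.HodgeStructure.ofConjBasis_piece {p q : ℤ}
    (hpq : p + q = n) :
    (HodgeStructure.ofConjBasis ω deg σ hσ hdeg).piece p q =
      Submodule.span ℂ (ω '' {k | deg k = p}) := by
  rw [HodgeStructure.piece_of_add_eq _ hpq, HodgeStructure.ofConjBasis_F,
    HodgeStructure.ofConjBasis_F, HodgeStructure.complexConj_span_image_deg_ge ω deg σ hσ hdeg q,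
    span_image_inf_span_image ω]
  congr 2
  ext k
  simp only [Set.mem_inter_iff, Set.mem_setOf_eq]
  omega

/-- The Hodge numbers of `ofConjBasis`: `h^{p,q} = #{k | deg k = p}` for `p + q = n`.
[cite: VoisinHodgeI2002, §7.1.1] -/
theorem _root_.Literature.AlgebraicGeometry.Motives.HodgeStructure.hodgeNumber_ofConjBasis
    [DecidableEq κ] {p q : ℤ} (hpq : p + q = n) :
    (HodgeStructure.ofConjBasis ω deg σ hσ hdeg).hodgeNumber p q =
      (Finset.univ.filter fun k ↦ deg k = p).card := by
  rw [HodgeStructure.hodgeNumber, HodgeStructure.ofConjBasis_piece ω deg σ hσ hdeg hpq]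
  have hset : ω '' {k | deg k = p} = Set.range fun k : {k // deg k = p} ↦ ω k := by
    ext x
    simp only [Set.mem_image, Set.mem_setOf_eq, Set.mem_range, Subtype.exists, exists_prop]
  have hli : LinearIndependent ℂ fun k : {k // deg k = p} ↦ ω k :=
    ω.linearIndependent.comp _ Subtype.val_injective
  rw [hset, finrank_span_eq_card hli, Fintype.card_subtype]

end OfConjBasis

/-! ### The Hodge structure `H¹(E_τ) ⊗ H¹(E_τ) ⊗ H¹(E_τ)` -/

namespace EllipticCurveCubed

/-- Index set of the tensor cube: for the RATIONAL basis `e_S = ⊗_a e_{S a}` (`e_false = dx_a`,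
`e_true = dy_a`), and for the basis of TYPES `ω_T = ⊗_a (dz_a if T a else dz̄_a)`.
[cite: LangeBirkenhake1992, §1.1.4 Prop. 1.1.20] -/
abbrev Idx : Type := Fin 3 → Bool

variable (τ : ℂ)

/-- The period of a factor of type `t`: `τ` for `dz = dx + τ dy` (`t = true`), `τ̄` for
`dz̄ = dx + τ̄ dy`. [cite: LangeBirkenhake1992, §1.1.5 Thm. 1.1.21] -/
def per (t : Bool) : ℂ := if t then τ else starRingEnd ℂ τ

/-- The `e_s`-coordinate of `dz` (`t = true`) resp. `dz̄`: `1` on `dx`, the period on `dy`.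
[cite: LangeBirkenhake1992, §1.1.5 Thm. 1.1.21] -/
def entry (t s : Bool) : ℂ := if s then per τ t else 1

/-- `ω_T = ⊗_a (dz_a or dz̄_a)` in the coordinates `e_S`: the product of the coordinates of its
factors (Lange–Birkenhake: the classes `dz_I ∧ dz̄_J` expanded in the lattice basis).
[cite: LangeBirkenhake1992, §1.1.5 Thm. 1.1.21 and Prop. 1.1.23] -/
def omegaFun (T : Idx) : Idx → ℂ := fun S ↦ ∏ a, entry τ (T a) (S a)

/-- Coefficients of the dual functionals: on one factor, `f ↦ f(dy) - (period of the OTHER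
type) · f(dx)` kills the other type. [folklore] -/
def dualCoef (u s : Bool) : ℂ := if s then 1 else -per τ (!u)

/-- The functional `λ_U = ⊗_a λ_{U a}` on `ℂ^{(Fin 3 → Bool)}`, dual (up to a non-zero factor) to
the family `ω_T`. [folklore] -/
def dualFun (U : Idx) : (Idx → ℂ) →ₗ[ℂ] ℂ where
  toFun f := ∑ S, (∏ a, dualCoef τ (U a) (S a)) * f S
  map_add' f g := by
    simp only [Pi.add_apply, mul_add, Finset.sum_add_distrib]
  map_smul' c f := by
    simp only [Pi.smul_apply, smul_eq_mul, RingHom.id_apply, Finset.mul_sum]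
    exact Finset.sum_congr rfl fun S _ ↦ by ring

/-- Unfolding of `dualFun`. [folklore] -/
theorem dualFun_apply (U : Idx) (f : Idx → ℂ) :
    dualFun τ U f = ∑ S, (∏ a, dualCoef τ (U a) (S a)) * f S :=
  rfl

/-- One factor: `λ_u(ω_t) = per t - per (¬u)`. [folklore] -/
theorem sum_dualCoef_mul_entry (u t : Bool) :
    ∑ s, dualCoef τ u s * entry τ t s = per τ t - per τ (!u) := by
  rw [Fintype.sum_bool]
  simp only [dualCoef, entry, if_true, Bool.false_eq_true, if_false]
  ring

/-- `λ_U(ω_T) = ∏_a (per (T a) - per (¬ U a))` (the sum over the `2³` coordinates of a product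
is the product of the sums). [folklore] -/
theorem dualFun_omegaFun (U T : Idx) :
    dualFun τ U (omegaFun τ T) = ∏ a, (per τ (T a) - per τ (!U a)) := by
  simp only [dualFun_apply, omegaFun, ← Finset.prod_mul_distrib]
  have h := Finset.prod_univ_sum (fun _ : Fin 3 ↦ (Finset.univ : Finset Bool))
    (fun a s ↦ dualCoef τ (U a) s * entry τ (T a) s)
  rw [Fintype.piFinset_univ] at h
  rw [← h]
  simp only [sum_dualCoef_mul_entry]

/-- `λ_U(ω_T) = 0` for `U ≠ T` (a factor with `U a ≠ T a` vanishes). [folklore] -/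
theorem dualFun_omegaFun_of_ne {U T : Idx} (h : U ≠ T) : dualFun τ U (omegaFun τ T) = 0 := by
  rw [dualFun_omegaFun]
  obtain ⟨a, ha⟩ := Function.ne_iff.1 h
  apply Finset.prod_eq_zero (Finset.mem_univ a)
  have hUT : (!U a) = T a := by
    cases hU : U a <;> cases hT : T a <;> simp_all
  rw [hUT, sub_self]

/-- `τ - τ̄ ≠ 0` for `Im τ ≠ 0`, in the form `per t - per (¬t) ≠ 0`. [folklore] -/
theorem per_sub_per_not_ne_zero (hτ : τ.im ≠ 0) (t : Bool) : per τ t - per τ (!t) ≠ 0 := by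
  have h : τ - starRingEnd ℂ τ ≠ 0 := by
    intro h0
    have him := congrArg Complex.im h0
    simp only [Complex.sub_im, Complex.conj_im, sub_neg_eq_add, Complex.zero_im] at him
    exact hτ (by linarith)
  cases t
  · simp only [per, Bool.false_eq_true, if_false, Bool.not_false, if_true]
    rwa [← neg_sub, neg_ne_zero]
  · simpa only [per, if_true, Bool.not_true, Bool.false_eq_true, if_false] using h

/-- `λ_T(ω_T) ≠ 0`. [folklore] -/
theorem dualFun_omegaFun_self_ne_zero (hτ : τ.im ≠ 0) (T : Idx) :
    dualFun τ T (omegaFun τ T) ≠ 0 := by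
  rw [dualFun_omegaFun]
  exact Finset.prod_ne_zero_iff.2 fun a _ ↦ per_sub_per_not_ne_zero τ hτ (T a)

/-- **The eight vectors `ω_T` are linearly independent** (for `Im τ ≠ 0`): apply the dual
functionals. (Lange–Birkenhake Thm. 1.1.21: the `dz_I ∧ dz̄_J` form a basis.)
[cite: LangeBirkenhake1992, §1.1.5 Thm. 1.1.21] -/
theorem linearIndependent_omegaFun (hτ : τ.im ≠ 0) : LinearIndependent ℂ (omegaFun τ) := by
  rw [Fintype.linearIndependent_iff]
  intro g hg U
  have h := congrArg (dualFun τ U) hg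
  rw [map_sum, map_zero, Finset.sum_eq_single U] at h
  · rw [map_smul, smul_eq_mul] at h
    exact (mul_eq_zero.1 h).resolve_right (dualFun_omegaFun_self_ne_zero τ hτ U)
  · intro T _ hTU
    rw [map_smul, dualFun_omegaFun_of_ne τ (Ne.symm hTU), smul_zero]
  · intro h
    exact absurd (Finset.mem_univ U) h

variable (hτ : τ.im ≠ 0)

/-- The basis `(ω_T)_T` of `ℂ^{(Fin 3 → Bool)}`. [cite: LangeBirkenhake1992, §1.1.5 Thm. 1.1.21] -/
def omegaBasisFun : Basis Idx ℂ (Idx → ℂ) :=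
  basisOfLinearIndependentOfCardEqFinrank (linearIndependent_omegaFun τ hτ)
    (Module.finrank_fintype_fun_eq_card ℂ).symm

/-- `omegaBasisFun` is the family `ω`. [folklore] -/
@[simp]
theorem omegaBasisFun_apply (T : Idx) : omegaBasisFun τ hτ T = omegaFun τ T := by
  rw [omegaBasisFun, coe_basisOfLinearIndependentOfCardEqFinrank]

/-- `λ_U` reads off the `U`-th `ω`-coordinate: `λ_U(y) = y_U · λ_U(ω_U)`. [folklore] -/
theorem dualFun_eq_repr_mul (U : Idx) (y : Idx → ℂ) :
    dualFun τ U y = (omegaBasisFun τ hτ).repr y U * dualFun τ U (omegaFun τ U) := by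
  conv_lhs => rw [← (omegaBasisFun τ hτ).sum_repr y]
  rw [map_sum, Finset.sum_eq_single U]
  · rw [map_smul, omegaBasisFun_apply, smul_eq_mul]
  · intro T _ hTU
    rw [map_smul, omegaBasisFun_apply, dualFun_omegaFun_of_ne τ (Ne.symm hTU), smul_zero]
  · intro h
    exact absurd (Finset.mem_univ U) h

/-- The `U`-th `ω`-coordinate vanishes iff `λ_U` does. [folklore] -/
theorem repr_eq_zero_iff (U : Idx) (y : Idx → ℂ) :
    (omegaBasisFun τ hτ).repr y U = 0 ↔ dualFun τ U y = 0 := by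
  rw [dualFun_eq_repr_mul τ hτ U y, mul_eq_zero,
    or_iff_left (dualFun_omegaFun_self_ne_zero τ hτ U)]

/-! #### Transport to the complexification `ℂ ⊗_ℚ ℚ^{(Fin 3 → Bool)}` -/

/-- The identification `ℂ ⊗_ℚ ℚ^{(Fin 3 → Bool)} ≃ ℂ^{(Fin 3 → Bool)}` (coordinates extend
scalars). [folklore] -/
def cubeCoord : ℂ ⊗[ℚ] (Idx → ℚ) ≃ₗ[ℂ] (Idx → ℂ) :=
  TensorProduct.piScalarRight ℚ ℂ ℂ Idx

/-- `cubeCoord (c ⊗ v) = (S ↦ v_S · c)`. [folklore] -/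
theorem cubeCoord_tmul (c : ℂ) (v : Idx → ℚ) :
    cubeCoord (c ⊗ₜ[ℚ] v) = fun S ↦ (v S : ℂ) * c := by
  ext S
  simp only [cubeCoord, TensorProduct.piScalarRight_apply, TensorProduct.piScalarRightHom_tmul,
    Rat.smul_def]

/-- A rational vector has coordinates its (rational) entries. [folklore] -/
theorem cubeCoord_ofRat (v : Idx → ℚ) : cubeCoord (ofRat v) = fun S ↦ (v S : ℂ) := by
  rw [ofRat_apply, cubeCoord_tmul]
  simp only [mul_one]

/-- Complex conjugation of `ℂ ⊗ V` is coordinatewise conjugation. [folklore] -/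
theorem cubeCoord_conj (x : ℂ ⊗[ℚ] (Idx → ℚ)) :
    cubeCoord (HodgeStructure.conj x) = fun S ↦ starRingEnd ℂ (cubeCoord x S) := by
  induction x using TensorProduct.induction_on with
  | zero =>
    ext S
    simp only [map_zero, Pi.zero_apply]
  | tmul c v =>
    ext S
    simp only [conj_tmul, cubeCoord_tmul, map_mul, map_ratCast]
  | add x y hx hy =>
    ext S
    simp only [map_add, Pi.add_apply, hx, hy]

/-- The basis `ω_T` transported to `ℂ ⊗_ℚ ℚ⁸`. [cite: LangeBirkenhake1992, §1.1.5 Thm. 1.1.21] -/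
def omegaBasis : Basis Idx ℂ (ℂ ⊗[ℚ] (Idx → ℚ)) :=
  (omegaBasisFun τ hτ).map cubeCoord.symm

/-- `omegaBasis T = cubeCoord⁻¹ (ω_T)`. [folklore] -/
theorem omegaBasis_apply (T : Idx) : omegaBasis τ hτ T = cubeCoord.symm (omegaFun τ T) := by
  rw [omegaBasis, Basis.map_apply, omegaBasisFun_apply]

/-- Coordinates in `omegaBasis` are the `ω`-coordinates of the coordinate vector. [folklore] -/
theorem omegaBasis_repr (x : ℂ ⊗[ℚ] (Idx → ℚ)) (T : Idx) :
    (omegaBasis τ hτ).repr x T = (omegaBasisFun τ hτ).repr (cubeCoord x) T := by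
  simp only [omegaBasis, Basis.map_repr, LinearEquiv.trans_apply, LinearEquiv.symm_symm]

/-- Conjugation on one factor swaps `dz` and `dz̄`: `conj (entry t s) = entry (¬t) s`. [folklore] -/
theorem conj_entry (t s : Bool) : starRingEnd ℂ (entry τ t s) = entry τ (!t) s := by
  cases s <;> cases t <;> simp [entry, per]

/-- `conj ω_T = ω_{¬T}` coordinatewise. [cite: LangeBirkenhake1992, §1.1.5 Prop. 1.1.23] -/
theorem conj_omegaFun (T S : Idx) :
    starRingEnd ℂ (omegaFun τ T S) = omegaFun τ (fun a ↦ !T a) S := by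
  simp only [omegaFun, map_prod, conj_entry]

/-- **Complex conjugation permutes the basis `ω`**: `conj ω_T = ω_{¬T}` (types `(p,q) ↔ (q,p)`).
[cite: LangeBirkenhake1992, §1.1.5 Prop. 1.1.23] -/
theorem conj_omegaBasis (T : Idx) :
    HodgeStructure.conj (omegaBasis τ hτ T) = omegaBasis τ hτ (fun a ↦ !T a) := by
  apply cubeCoord.injective
  rw [cubeCoord_conj, omegaBasis_apply, omegaBasis_apply, LinearEquiv.apply_symm_apply,
    LinearEquiv.apply_symm_apply]
  ext S
  exact conj_omegaFun τ T S

/-- The type `p` of `ω_T`: the number of holomorphic factors `dz`. [cite: LangeBirkenhake1992, §1.1.5 Thm. 1.1.21] -/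
def cubeDeg (T : Idx) : ℤ := ((Finset.univ.filter fun a ↦ T a = true).card : ℕ)

/-- `p + q = 3`: the complementary type has the complementary number of `dz`'s. [folklore] -/
theorem cubeDeg_add_cubeDeg_not (T : Idx) : cubeDeg T + cubeDeg (fun a ↦ !T a) = 3 := by
  revert T
  decide

/-- Only `ω_{dz̄dz̄dz̄}` has type `p = 0`. [folklore] -/
theorem cubeDeg_lt_one_iff (T : Idx) : cubeDeg T < 1 ↔ T = fun _ ↦ false := by
  revert T
  decide

/-- **The Hodge structure `H¹(E_τ, ℚ) ⊗ H¹(E_τ, ℚ) ⊗ H¹(E_τ, ℚ)`** (weight `3`, on `ℚ⁸`) of the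
cube of the elliptic curve `E_τ = ℂ/(ℤ + τℤ)`, `Im τ ≠ 0`: `F^p` is spanned by the
`ω_T = ⊗_a (dz_a or dz̄_a)` with at least `p` factors `dz` — the Künneth component
`H¹ ⊗ H¹ ⊗ H¹` of the Hodge structure `H³(E_τ³, ℚ)` (Hodge decomposition of a complex torus:
`H^{p,q}` is spanned by the `dz_I ∧ dz̄_J`, `#I = p`, `#J = q`, Lange–Birkenhake Thm. 1.1.21 and
Prop. 1.1.23; Hodge structure of a product, Voisin I Thm. 11.40), on which Grothendieck's count
"`2ⁱ - N`" takes place. [cite: LangeBirkenhake1992, §1.1.5 Thm. 1.1.21 and Prop. 1.1.23]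
[cite: GrothendieckTopology1969, p. 300] -/
def hodgeStructure : HodgeStructure (Idx → ℚ) 3 :=
  HodgeStructure.ofConjBasis (omegaBasis τ hτ) cubeDeg (fun T a ↦ !T a) (conj_omegaBasis τ hτ)
    cubeDeg_add_cubeDeg_not

/-- Its Hodge numbers are `(h^{3,0}, h^{2,1}, h^{1,2}, h^{0,3}) = (1, 3, 3, 1)`.
[cite: LangeBirkenhake1992, §1.1.5 Thm. 1.1.21] -/
theorem hodgeNumber_hodgeStructure :
    (hodgeStructure τ hτ).hodgeNumber 3 0 = 1 ∧ (hodgeStructure τ hτ).hodgeNumber 2 1 = 3 ∧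
      (hodgeStructure τ hτ).hodgeNumber 1 2 = 3 ∧ (hodgeStructure τ hτ).hodgeNumber 0 3 = 1 := by
  refine ⟨?_, ?_, ?_, ?_⟩ <;>
    rw [hodgeStructure, HodgeStructure.hodgeNumber_ofConjBasis _ _ _ _ _ (by norm_num)] <;>
    decide

/-- **Hodge's `V ∩ F¹` in the cube**: a rational vector lies in `F¹ = H^{3,0} ⊕ H^{2,1} ⊕ H^{1,2}`
iff its `ω_{dz̄dz̄dz̄}`-coordinate vanishes. [cite: GrothendieckTopology1969, p. 300] -/
theorem mem_hodgeClasses_one_iff (v : Idx → ℚ) :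
    v ∈ (hodgeStructure τ hτ).hodgeClasses 1 ↔
      dualFun τ (fun _ ↦ false) (cubeCoord (ofRat v)) = 0 := by
  rw [hodgeStructure, HodgeStructure.mem_hodgeClasses_ofConjBasis_iff, ← repr_eq_zero_iff τ hτ,
    ← omegaBasis_repr]
  constructor
  · intro h
    exact h _ ((cubeDeg_lt_one_iff _).2 rfl)
  · intro h T hT
    obtain rfl := (cubeDeg_lt_one_iff T).1 hT
    exact h

/-! #### Grothendieck's count `2³ - N` -/

/-- The number of `dx`-factors of `e_S` (coordinates `S a = false`): the exponent of `-τ` in the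
`e_S`-coefficient of the `dz̄dz̄dz̄`-functional. [folklore] -/
def numFalse (S : Idx) : ℕ := (Finset.univ.filter fun a ↦ S a = false).card

/-- `numFalse S ≤ 3 < 4`. [folklore] -/
theorem numFalse_lt_four (S : Idx) : numFalse S < 4 :=
  (Finset.card_filter_le _ _).trans_lt (by simp)

/-- The coefficient of `e_S` in the `dz̄dz̄dz̄`-functional is `(-τ)^{#{a | ¬ S a}}`. [folklore] -/
theorem prod_dualCoef_false (S : Idx) :
    ∏ a, dualCoef τ false (S a) = (-τ) ^ numFalse S := by
  simp only [dualCoef, Bool.not_false, per, if_true]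
  rw [Finset.prod_ite, Finset.prod_const_one, one_mul, Finset.prod_const, numFalse]
  congr 2
  ext a
  simp

/-- The fibre sums `Σ_{#{a | ¬S a} = j} v_S` (`j = 0, …, 3`), `ℚ`-linear in `v`: the rational
coordinates against which the periods `(-τ)^j` appear. [cite: GrothendieckTopology1969, p. 300] -/
def fiberSum (j : ℕ) : (Idx → ℚ) →ₗ[ℚ] ℚ :=
  ∑ S ∈ Finset.univ.filter (fun S ↦ numFalse S = j), LinearMap.proj S

/-- Unfolding of `fiberSum`. [folklore] -/
theorem fiberSum_apply (j : ℕ) (v : Idx → ℚ) :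
    fiberSum j v = ∑ S ∈ Finset.univ.filter (fun S ↦ numFalse S = j), v S := by
  simp only [fiberSum, LinearMap.coe_sum, Finset.sum_apply, LinearMap.coe_proj,
    Function.eval]

/-- The `dz̄dz̄dz̄`-functional on a rational vector, grouped by powers of `-τ`:
`Σ_S (-τ)^{#¬S} v_S = Σ_{j<4} (-τ)^j · fiberSum j v`. [cite: GrothendieckTopology1969, p. 300] -/
theorem dualFun_false_ofRat (v : Idx → ℚ) :
    dualFun τ (fun _ ↦ false) (cubeCoord (ofRat v)) =
      ∑ j ∈ Finset.range 4, (-τ) ^ j * (fiberSum j v : ℂ) := by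
  rw [cubeCoord_ofRat, dualFun_apply]
  simp only [prod_dualCoef_false]
  rw [← Finset.sum_fiberwise_of_maps_to (s := Finset.univ) (t := Finset.range 4) (g := numFalse)
    fun S _ ↦ Finset.mem_range.2 (numFalse_lt_four S)]
  refine Finset.sum_congr rfl fun j _ ↦ ?_
  rw [fiberSum_apply, Rat.cast_sum, Finset.mul_sum]
  refine Finset.sum_congr rfl fun S hS ↦ ?_
  rw [(Finset.mem_filter.1 hS).2]

/-- Fibre sums of coordinate vectors. [folklore] -/
theorem fiberSum_single (j : ℕ) (S₀ : Idx) :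
    fiberSum j (Pi.single S₀ 1) = if numFalse S₀ = j then 1 else 0 := by
  rw [fiberSum_apply]
  split_ifs with h
  · rw [Finset.sum_eq_single S₀]
    · simp
    · intro S _ hS
      simp [Pi.single_eq_of_ne hS]
    · intro hS
      exact (hS (Finset.mem_filter.2 ⟨Finset.mem_univ S₀, h⟩)).elim
  · refine Finset.sum_eq_zero fun S hS ↦ ?_
    have hne : S ≠ S₀ := fun hSS ↦ h (hSS ▸ (Finset.mem_filter.1 hS).2)
    simp [Pi.single_eq_of_ne hne]

/-- **Grothendieck's period relation** as a `ℚ`-linear map `ℚ⁸ → ℂ`: the `dz̄dz̄dz̄`-functional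
on rational vectors, `v ↦ Σ_S (-τ)^{#{a | ¬ S a}} v_S = Σⱼ (-τ)ʲ fⱼ(v)` — its values are the
rational combinations of the `j`-fold products `τʲ` of the periods ("the coefficients of the
polynomial `∏_α (1 + τ_α T)`", here `(1 + τT)³`), and its kernel is Hodge's `V ∩ F¹`.
[cite: GrothendieckTopology1969, p. 300] -/
def periodRel : (Idx → ℚ) →ₗ[ℚ] ℂ :=
  (dualFun τ (fun _ ↦ false)).restrictScalars ℚ ∘ₗ cubeCoord.toLinearMap.restrictScalars ℚ ∘ₗ
    HodgeStructure.ofRat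

/-- Unfolding of `periodRel`. [folklore] -/
theorem periodRel_apply (v : Idx → ℚ) :
    periodRel τ v = dualFun τ (fun _ ↦ false) (cubeCoord (ofRat v)) :=
  rfl

/-- `periodRel v = Σ_{j<4} (-τ)ʲ · fiberSum j v`. [cite: GrothendieckTopology1969, p. 300] -/
theorem periodRel_eq_sum (v : Idx → ℚ) :
    periodRel τ v = ∑ j ∈ Finset.range 4, (-τ) ^ j * (fiberSum j v : ℂ) := by
  rw [periodRel_apply, dualFun_false_ofRat]

/-- **Hodge's `V ∩ F¹` is the kernel of the period relation** (any `τ` with `Im τ ≠ 0`).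
[cite: GrothendieckTopology1969, p. 300] -/
theorem hodgeClasses_one_eq_ker : (hodgeStructure τ hτ).hodgeClasses 1 = LinearMap.ker (periodRel τ) := by
  ext v
  rw [mem_hodgeClasses_one_iff, LinearMap.mem_ker, periodRel_apply]

/-- Every exponent `j < 4` occurs as `#{a | ¬ S a}`. [folklore] -/
theorem exists_numFalse_eq (j : Fin 4) : ∃ S : Idx, numFalse S = (j : ℕ) := by
  revert j
  decide

/-- **The values of the period relation are the rational span of `1, -τ, τ², -τ³`** ("the
vector space over `ℚ` generated by all `j`-fold products […] of `τ_α`'s"): `≤` termwise, `≥`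
by evaluating on a coordinate vector `e_S` with `#{a | ¬ S a} = j`.
[cite: GrothendieckTopology1969, p. 300] -/
theorem range_periodRel :
    LinearMap.range (periodRel τ) = Submodule.span ℚ (Set.range fun j : Fin 4 ↦ (-τ) ^ (j : ℕ)) := by
  refine le_antisymm ?_ ?_
  · rintro _ ⟨v, rfl⟩
    rw [periodRel_eq_sum, Finset.sum_range]
    refine Submodule.sum_mem _ fun j _ ↦ ?_
    rw [mul_comm, ← Rat.smul_def]
    exact Submodule.smul_mem _ _ (Submodule.subset_span ⟨j, rfl⟩)
  · rw [Submodule.span_le]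
    rintro _ ⟨j, rfl⟩
    obtain ⟨S, hS⟩ := exists_numFalse_eq j
    refine ⟨Pi.single S 1, ?_⟩
    rw [periodRel_eq_sum]
    simp only [fiberSum_single, hS, apply_ite (Rat.cast : ℚ → ℂ), Rat.cast_one, Rat.cast_zero,
      mul_ite, mul_one, mul_zero, Finset.sum_ite_eq, Finset.mem_range, Fin.is_lt, if_true]

/-- `1, -τ, τ², -τ³` and `1, τ, τ², τ³` have the same rational span. [folklore] -/
theorem span_neg_pow_eq (x : ℂ) (m : ℕ) :
    Submodule.span ℚ (Set.range fun j : Fin m ↦ (-x) ^ (j : ℕ)) =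
      Submodule.span ℚ (Set.range fun j : Fin m ↦ x ^ (j : ℕ)) := by
  have key : ∀ y : ℂ, Submodule.span ℚ (Set.range fun j : Fin m ↦ (-y) ^ (j : ℕ)) ≤
      Submodule.span ℚ (Set.range fun j : Fin m ↦ y ^ (j : ℕ)) := by
    intro y
    rw [Submodule.span_le]
    rintro _ ⟨j, rfl⟩
    have h : (-y) ^ (j : ℕ) = ((-1 : ℚ) ^ (j : ℕ)) • y ^ (j : ℕ) := by
      rw [neg_pow, Rat.smul_def]
      push_cast
      ring
    change (-y) ^ (j : ℕ) ∈ Submodule.span ℚ (Set.range fun j : Fin m ↦ y ^ (j : ℕ))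
    rw [h]
    exact Submodule.smul_mem _ _ (Submodule.subset_span ⟨j, rfl⟩)
  refine le_antisymm (key x) ?_
  simpa only [neg_neg] using key (-x)

/-- **Grothendieck's count `rank (Filt¹ ∩ H_ℚ) = 2ⁱ - N`** (`i = 3`, three equal periods): for
every `τ` with `Im τ ≠ 0`, the `ℚ`-dimension of Hodge's `V ∩ F¹` in `H¹(E_τ)^{⊗3}` plus
`N = dim_ℚ ⟨1, τ, τ², τ³⟩_ℚ` is `2³` (rank–nullity for the period relation). Verbatim: "The rank of
`Filt¹ Hⁱ(X, ℚ)` […] is immediately computed, it is equal to `2ⁱ - N`, where `N` is the rank of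
the vector space over `ℚ` generated by all `j`-fold products, `0 ≤ j ≤ i`, of `τ_α`'s with
distinct indices". [cite: GrothendieckTopology1969, p. 300] -/
theorem finrank_hodgeClasses_one_add_finrank_span_pow :
    Module.finrank ℚ ((hodgeStructure τ hτ).hodgeClasses 1) +
      Module.finrank ℚ (Submodule.span ℚ (Set.range fun j : Fin 4 ↦ τ ^ (j : ℕ))) = 2 ^ 3 := by
  rw [hodgeClasses_one_eq_ker τ hτ, ← span_neg_pow_eq, ← range_periodRel, add_comm,
    LinearMap.finrank_range_add_finrank_ker, Module.finrank_fintype_fun_eq_card]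
  rfl

/-- For `τ³ = 2`: `⟨1, τ, τ², τ³⟩_ℚ = ⟨1, τ, τ²⟩_ℚ`. [folklore] -/
theorem span_pow_eq_of_cubic (h3 : τ ^ 3 = 2) :
    Submodule.span ℚ (Set.range fun j : Fin 4 ↦ τ ^ (j : ℕ)) =
      Submodule.span ℚ (Set.range ![(1 : ℂ), τ, τ ^ 2]) := by
  refine le_antisymm ?_ ?_
  · rw [Submodule.span_le]
    rintro _ ⟨j, rfl⟩
    fin_cases j
    · exact Submodule.subset_span ⟨0, by simp⟩
    · exact Submodule.subset_span ⟨1, by simp⟩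
    · exact Submodule.subset_span ⟨2, by simp⟩
    · have h : τ ^ 3 = (2 : ℚ) • ![(1 : ℂ), τ, τ ^ 2] 0 := by
        rw [h3, Matrix.cons_val_zero, Rat.smul_def, Rat.cast_ofNat, mul_one]
      show τ ^ 3 ∈ Submodule.span ℚ (Set.range ![(1 : ℂ), τ, τ ^ 2])
      rw [h]
      exact Submodule.smul_mem _ _ (Submodule.subset_span ⟨0, rfl⟩)
  · rw [Submodule.span_le]
    rintro _ ⟨i, rfl⟩
    fin_cases i
    · exact Submodule.subset_span ⟨0, by simp⟩
    · exact Submodule.subset_span ⟨1, by simp⟩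
    · exact Submodule.subset_span ⟨2, by simp⟩

/-- **`2³ - N = 5` for `τ` cubic**: Hodge's space `V ∩ F¹` of `H¹(E_τ)^{⊗3}` has `ℚ`-dimension
`8 - 3 = 5` — ODD — when `τ³ = 2` and `1, τ, τ²` are linearly independent over `ℚ` (`N = 3`).
"If `i` is odd, this rank may well be odd; for instance if `i = 3`, and all `τᵢ` equal to the same
`τ`, this will happen exactly when `τ` is cubic over `ℚ`." [cite: GrothendieckTopology1969, p. 300] -/
theorem finrank_hodgeClasses_one (h3 : τ ^ 3 = 2) (hli : LinearIndependent ℚ ![(1 : ℂ), τ, τ ^ 2]) :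
    Module.finrank ℚ ((hodgeStructure τ hτ).hodgeClasses 1) = 5 := by
  have h := finrank_hodgeClasses_one_add_finrank_span_pow τ hτ
  rw [span_pow_eq_of_cubic τ h3, finrank_span_eq_card hli, Fintype.card_fin] at h
  omega

/-- **Hodge's `V ∩ F¹` of `H¹(E_τ)^{⊗3}`, `τ` cubic, underlies no sub-Hodge structure** (odd
dimension `5` in odd weight `3`): Grothendieck's "intrinsic condition" fails.
[cite: GrothendieckTopology1969, p. 300] -/
theorem toSubmodule_ne_hodgeClasses_one (h3 : τ ^ 3 = 2)
    (hli : LinearIndependent ℚ ![(1 : ℂ), τ, τ ^ 2])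
    (S : (hodgeStructure τ hτ).SubHodgeStructure) :
    S.toSubmodule ≠ (hodgeStructure τ hτ).hodgeClasses 1 :=
  S.toSubmodule_ne_of_odd_finrank (by decide)
    (by rw [finrank_hodgeClasses_one τ hτ h3 hli]; decide)

end EllipticCurveCubed

/-! ### The barrier on the abstract layer -/

/-- **Hodge's general conjecture is false for trivial reasons — the printed theorem, on the
abstract layer of `ℚ`-Hodge structures.** There is a period `τ` in the upper half plane, cubic
over `ℚ` (`τ³ = 2`, `1, τ, τ²` linearly independent: `exists_cubic_tau`), such that in the
weight-`3` Hodge structure `H = H¹(E_τ, ℚ)^{⊗3}` (`EllipticCurveCubed.hodgeStructure τ`, Hodge numbers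
`1, 3, 3, 1`) Hodge's right hand side of (∗), `W = H_ℚ ∩ F¹H_ℂ` (`H.hodgeClasses 1`), has ODD
`ℚ`-dimension `2³ - N = 5` and therefore is the underlying `ℚ`-space of NO sub-Hodge structure of
`H` (sub-Hodge structures of odd weight have even rank). Since `Filt'¹ = N¹H³(E_τ³, ℚ)` spans a
sub-Hodge structure contained in `F¹` (Grothendieck p. 300, footnote †: Deligne; tree:
`Grothendieck1969_supportedClasses_isSubHodge`, `…_le_hodgeFiltration`) and `H` is the Künneth
component `H¹ ⊗ H¹ ⊗ H¹` of `H³(E_τ³, ℚ)` (tree: `Grothendieck1969_ellipticCurveCubed_hodgeDecomposition`),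
Hodge's equality `Filt'¹ = F¹ ∩ H³_ℚ` fails on `E_τ³` — the geometric form
`Grothendieck1969_generalHodgeConjecture_false`, closed in the tree modulo those named facts
(`Grothendieck1969_generalHodgeConjecture_false_of_deRham`). Verbatim: "Now equality in (∗) would
imply a highly non trivial intrinsic condition on the Hodge structure `Hⁱ(X^an, ℂ)`, namely that
the `ℂ`-vector-subspace generated by the right hand side of (∗) is a sub-Hodge structure; If `i`
is odd, this would imply for instance that the dimension over `ℚ` of that space is even. […] for
instance if `i = 3`, and all `τᵢ` equal to the same `τ`, this will happen exactly when `τ` is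
cubic over `ℚ`." [cite: GrothendieckTopology1969, p. 300]

BARRIER (D-0021) — the abstract-layer form of the catalogue entry
`Grothendieck1969_generalHodgeConjecture_false` (same technique class; this form is a THEOREM)
* technique_class: hodge-filtration-level, coniveau, generalized-hodge-original, classwise-level-criteria
* blocks: on the abstract Betti–Hodge layer (`Motives/HodgeStructure`, `Motives/AbstractHodgeTate`, `BettiHodgeData.GeneralizedHodgeConjectureFor`) every formulation asserting that Hodge's `V ∩ Fᵖ` (`HodgeStructure.hodgeClasses p`) of the Hodge structure of a smooth projective variety underlies a sub-Hodge structure — in particular Hodge's original general conjecture `Nᵖ Hⁱ(X, ℚ) = Hⁱ(X, ℚ) ∩ Fᵖ` and class-by-class level criteria for `Nᵖ` [cite: GrothendieckTopology1969, p. 300]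
* because: a sub-Hodge structure of odd weight has even `ℚ`-rank (`SubHodgeStructure.even_finrank`), while `dim_ℚ (V ∩ F¹) = 2³ - N = 5` for `V = H¹(E_τ)^{⊗3}`, `τ` cubic (`EllipticCurveCubed.finrank_hodgeClasses_one`) [cite: GrothendieckTopology1969, p. 300]
* evasions_known: Grothendieck's amended generalised Hodge conjecture — `Nᵖ` is the LARGEST sub-Hodge structure inside `V ∩ Fᵖ` (tree: `Literature.AlgebraicGeometry.Motives.GeneralizedHodgeConjecture`, `BettiHodgeData.GeneralizedHodgeConjectureFor`) [cite: GrothendieckTopology1969, pp. 300–301] [cite: VoisinHodgeI2002, §11.3.2 Conj. 11.37]; the CM locus, where `V ∩ Fᵖ` IS a sub-Hodge structure (`GeneralizedHodgeTrivialReasonsNarrow`, `GeneralizedHodgeTrivialReasons.lean`) [cite: Abdulali2005CMHodge, §2]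
* scope_caveats: proved for the abstract Hodge structure `EllipticCurveCubed.hodgeStructure τ` (= `H¹ ⊗ H¹ ⊗ H¹` of `E_τ³` by Lange–Birkenhake Thm. 1.1.21 / Prop. 1.1.23); the identification with the tree's singular cohomology of the scheme `E_τ³` (`Grothendieck1969_ellipticCurveCubed_hodgeDecomposition`) and the sub-Hodge property of `N¹` (`Grothendieck1969_supportedClasses_isSubHodge`) are named facts, through which the geometric form `Grothendieck1969_generalHodgeConjecture_false` follows (`…_of_deRham`, `…SubHodgeOfFacts.lean`); the parity mechanism certifies only ODD-rank failures
* status: established -/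
theorem Grothendieck1969_hodgeGeneralConjecture_false_abstract :
    ∃ (τ : ℂ) (hτ : 0 < τ.im), τ ^ 3 = 2 ∧ LinearIndependent ℚ ![(1 : ℂ), τ, τ ^ 2] ∧
      Module.finrank ℚ ((EllipticCurveCubed.hodgeStructure τ hτ.ne').hodgeClasses 1) = 5 ∧
        ∀ S : (EllipticCurveCubed.hodgeStructure τ hτ.ne').SubHodgeStructure,
          S.toSubmodule ≠ (EllipticCurveCubed.hodgeStructure τ hτ.ne').hodgeClasses 1 := by
  obtain ⟨τ, hτ, h3, hli⟩ := exists_cubic_tau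
  exact ⟨τ, hτ, h3, hli, EllipticCurveCubed.finrank_hodgeClasses_one τ hτ.ne' h3 hli,
    EllipticCurveCubed.toSubmodule_ne_hodgeClasses_one τ hτ.ne' h3 hli⟩

/-- The same for EVERY cubic period: whenever `Im τ ≠ 0`, `τ³ = 2` and `1, τ, τ²` are linearly
independent over `ℚ`, Hodge's `V ∩ F¹` of `H¹(E_τ)^{⊗3}` has rank `5` and underlies no sub-Hodge
structure (the universally quantified form; its hypotheses are inhabited by `exists_cubic_tau`).
[cite: GrothendieckTopology1969, p. 300] -/
theorem Grothendieck1969_hodgeGeneralConjecture_false_abstract_of_cubic (τ : ℂ) (hτ : τ.im ≠ 0)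
    (h3 : τ ^ 3 = 2) (hli : LinearIndependent ℚ ![(1 : ℂ), τ, τ ^ 2]) :
    Module.finrank ℚ ((EllipticCurveCubed.hodgeStructure τ hτ).hodgeClasses 1) = 5 ∧
      ∀ S : (EllipticCurveCubed.hodgeStructure τ hτ).SubHodgeStructure,
        S.toSubmodule ≠ (EllipticCurveCubed.hodgeStructure τ hτ).hodgeClasses 1 :=
  ⟨EllipticCurveCubed.finrank_hodgeClasses_one τ hτ h3 hli,
    EllipticCurveCubed.toSubmodule_ne_hodgeClasses_one τ hτ h3 hli⟩

end Literature.Barriers.HodgeConjecture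

end
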